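import Literature.Analysis.FluidPDE.LocalLerayCubicIntegrability
import Literature.Analysis.FluidPDE.SobolevSixBall
import HarnessLib

/-!
# Jia–Šverák 2014, proof of Thm. 3.1: the cubic integral on a cylinder `(0,t) × B_R(y)`

Analysis/FluidPDE proofs file (theorems only, no new definitions, no new named facts), part of
the proof of the named fact `Literature.Analysis.FluidPDE.jia_sverak_2014_theorem_3_2`
(`JiaSverak2014LocalRegularity.lean`; H. Jia, V. Šverák, Invent. Math. 196 (2014) =
arXiv:1204.0529, §3 Thm. 3.2). The printed proof of Thm. 3.1 (arXiv p. 8) estimates the local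
energy of `v = u - a` on balls with "well-known interpolation inequalities" (`L^∞L² ∩ L²H¹ ⊂ L³`
with the factor `t^{1/4}`); the tree proves the quantitative form on the unit cylinder
`(0,t) × B₁(0)` (`exists_lintegral_cube_cylinder_le`, Lemarié-Rieusset 2016, (13.17)–(13.18)).
This file records the same estimate on `(0,t) × B_R(y)` for any radius `R` and centre `y`
(the proof verbatim, with the uniform Sobolev inequality on balls of radius `R`,
`exists_eLpNorm_six_le_ball_uniform`):

* `exists_lintegral_cube_cylinder_le_ball` — `∫∫_{(0,t)×B_R(y)} |u|³ ≤ K(R) C^{3/2} (t + t^{1/4})`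
  whenever `∫_{B_R(y)} |u(s)|² ≤ C` for a.e. `s ∈ (0,T)` and `∫∫_{(0,T)×B_R(y)} |G|² ≤ C`, `G` a weak
  spatial gradient of `u` on the cylinder, `0 < t ≤ T`.

## References

* H. Jia, V. Šverák, Invent. Math. 196 (2014) = arXiv:1204.0529, §3, proof of Thm. 3.1 (p. 8).
  Bib key `JiaSverak2014`.
* P. G. Lemarié-Rieusset, *The Navier–Stokes Problem in the 21st Century* (2016), (13.17)–(13.18)
  p. 461, Prop. 14.1. Bib key `LemarieRieusset2016`.
-/

noncomputable section

open MeasureTheory Set Function Filter Topology TopologicalSpace Metric Module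
open scoped NNReal ENNReal InnerProductSpace RealInnerProductSpace

namespace Literature.Analysis.FluidPDE

namespace JiaSverak2014

/-- **`∫∫_{(0,t) × B_R(y)} |u|³ ≤ K(R) C^{3/2} (t + t^{1/4})`** (Lemarié-Rieusset 2016, (13.17)–(13.18)
and Prop. 14.1, on a ball of radius `R`; the tree's `exists_lintegral_cube_cylinder_le` is the
case `R = 1`, `y = 0`). The constant depends on `R` only (uniform Sobolev constant on balls of
radius `R`, `exists_eLpNorm_six_le_ball_uniform`). [cite: LemarieRieusset2016, (13.17)–(13.18) p. 461] -/
theorem exists_lintegral_cube_cylinder_le_ball (R : ℝ) :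
    ∃ K : ℝ≥0, ∀ (u : ℝ → (EuclideanSpace ℝ (Fin 3)) → (EuclideanSpace ℝ (Fin 3)))
      (G : ℝ → (EuclideanSpace ℝ (Fin 3)) → (EuclideanSpace ℝ (Fin 3)) →L[ℝ] (EuclideanSpace ℝ (Fin 3))) (T : ℝ) (C : ℝ≥0) (t : ℝ)
      (y : EuclideanSpace ℝ (Fin 3)),
      HasWeakSpatialGradientOn (timeCylinder (⟨ball y R, isOpen_ball⟩ : Opens (EuclideanSpace ℝ (Fin 3))) 0 T) u G →
      (∀ᵐ s ∂(volume.restrict (Ioo 0 T)), ∫⁻ x in ball y R, ‖u s x‖ₑ ^ 2 ≤ C) →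
      ∫⁻ z in Ioo 0 T ×ˢ ball y R, ENNReal.ofReal (frobeniusNormSq (G z.1 z.2)) ≤ C →
      0 < t → t ≤ T →
      ∫⁻ z in Ioo 0 t ×ˢ ball y R, ‖u z.1 z.2‖ₑ ^ (3 : ℕ) ≤
        K * (C : ℝ≥0∞) ^ (3 / 2 : ℝ) * (ENNReal.ofReal t + ENNReal.ofReal (t ^ (1 / 4 : ℝ))) := by
  obtain ⟨CS, hCS⟩ := exists_eLpNorm_six_le_ball_uniform (E := EuclideanSpace ℝ (Fin 3)) finrank_euclideanSpace_fin R
  refine ⟨(2 * CS) ^ (3 / 2 : ℝ), fun u G T C t y h hE hGb ht htT => ?_⟩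
  -- notation
  set B : Set (EuclideanSpace ℝ (Fin 3)) := ball y R with hB
  set Ω : Opens (EuclideanSpace ℝ (Fin 3)) := ⟨ball y R, isOpen_ball⟩ with hΩ
  set I : Set ℝ := Ioo 0 T with hI
  set J : Set ℝ := Ioo 0 t with hJ
  set a : ℝ → ℝ≥0∞ := fun s => ∫⁻ x in B, ‖u s x‖ₑ ^ 2 with ha
  set e : ℝ → ℝ≥0∞ := fun s => ∫⁻ x in B, ENNReal.ofReal (frobeniusNormSq (G s x)) with he
  set c : ℝ → ℝ≥0∞ := fun s => ∫⁻ x in B, ‖u s x‖ₑ ^ (3 : ℕ) with hc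
  have hJI : J ⊆ I := Ioo_subset_Ioo_right htT
  -- measurability on the cylinders
  have hQsub : I ×ˢ B ⊆ ((timeCylinder Ω 0 T : Opens (ℝ × (EuclideanSpace ℝ (Fin 3)))) : Set (ℝ × (EuclideanSpace ℝ (Fin 3)))) :=
    fun z hz => hz
  have hum : AEStronglyMeasurable (uncurry u) (volume.restrict (I ×ˢ B)) :=
    (h.locallyIntegrableOn.mono_set hQsub).aestronglyMeasurable
  have hGm : AEStronglyMeasurable (uncurry G) (volume.restrict (I ×ˢ B)) :=
    (h.locallyIntegrableOn_grad.mono_set hQsub).aestronglyMeasurable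
  have humJ : AEStronglyMeasurable (uncurry u) (volume.restrict (J ×ˢ B)) :=
    hum.mono_measure (Measure.restrict_mono (prod_mono hJI Subset.rfl) le_rfl)
  have hprodI : (volume.restrict (I ×ˢ B) : Measure (ℝ × (EuclideanSpace ℝ (Fin 3)))) =
      (volume.restrict I).prod (volume.restrict B) := by
    rw [Measure.volume_eq_prod, Measure.prod_restrict]
  have hprodJ : (volume.restrict (J ×ˢ B) : Measure (ℝ × (EuclideanSpace ℝ (Fin 3)))) =
      (volume.restrict J).prod (volume.restrict B) := by
    rw [Measure.volume_eq_prod, Measure.prod_restrict]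
  have hum3 : AEMeasurable (fun q : ℝ × (EuclideanSpace ℝ (Fin 3)) => ‖u q.1 q.2‖ₑ ^ (3 : ℕ))
      ((volume.restrict J).prod (volume.restrict B)) := by
    rw [← hprodJ]; exact (humJ.enorm.pow_const 3)
  have hum2 : AEMeasurable (fun q : ℝ × (EuclideanSpace ℝ (Fin 3)) => ‖u q.1 q.2‖ₑ ^ (2 : ℕ))
      ((volume.restrict I).prod (volume.restrict B)) := by
    rw [← hprodI]; exact (hum.enorm.pow_const 2)
  have hGm2 : AEMeasurable (fun q : ℝ × (EuclideanSpace ℝ (Fin 3)) => ENNReal.ofReal (frobeniusNormSq (G q.1 q.2)))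
      ((volume.restrict I).prod (volume.restrict B)) := by
    rw [← hprodI]
    exact (continuous_frobeniusNormSq'.comp_aestronglyMeasurable hGm).aemeasurable.ennreal_ofReal
  -- Tonelli
  have hEeq : ∫⁻ z in I ×ˢ B, ENNReal.ofReal (frobeniusNormSq (G z.1 z.2)) = ∫⁻ s in I, e s := by
    rw [Measure.volume_eq_prod, setLIntegral_prod _ (by rwa [← Measure.prod_restrict])]
  have hCeq : ∫⁻ z in J ×ˢ B, ‖u z.1 z.2‖ₑ ^ (3 : ℕ) = ∫⁻ s in J, c s := by
    rw [Measure.volume_eq_prod, setLIntegral_prod _ (by rwa [← Measure.prod_restrict])]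
  have ham : AEMeasurable a (volume.restrict I) := hum2.lintegral_prod_right'
  have hem : AEMeasurable e (volume.restrict I) := hGm2.lintegral_prod_right'
  have hamJ : AEMeasurable a (volume.restrict J) :=
    ham.mono_measure (Measure.restrict_mono hJI le_rfl)
  have hemJ : AEMeasurable e (volume.restrict J) :=
    hem.mono_measure (Measure.restrict_mono hJI le_rfl)
  -- a.e. in time: energy bound, finite dissipation, weak derivative of the slice
  have h1 : ∀ᵐ s ∂(volume.restrict I), a s ≤ C := hE
  have hEfin : ∫⁻ s in I, e s ≤ C := by rw [← hEeq]; exact hGb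
  have h2 : ∀ᵐ s ∂(volume.restrict I), e s < ∞ :=
    ae_lt_top' hem (ne_top_of_le_ne_top ENNReal.coe_ne_top hEfin)
  have h3 : ∀ᵐ s ∂(volume.restrict I),
      FunctionSpaces.HasWeakFDerivOn Ω volume (u s) (G s) :=
    HasWeakSpatialGradientOn.ae_hasWeakFDerivOn_slice (Ω := Ω) h
  -- the pointwise-in-time estimate
  set M : ℝ≥0∞ := ((2 * CS : ℝ≥0) : ℝ≥0∞) ^ (3 / 2 : ℝ) with hM
  have hpt : ∀ᵐ s ∂(volume.restrict I),
      c s ≤ (C : ℝ≥0∞) ^ (3 / 4 : ℝ) * (M * (a s + e s) ^ (3 / 4 : ℝ)) := by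
    filter_upwards [h1, h2, h3] with s has hes hws
    have has' : a s ≠ ∞ := ne_top_of_le_ne_top ENNReal.coe_ne_top has
    have hutm : AEStronglyMeasurable (u s) (volume.restrict B) :=
      hws.locallyIntegrableOn.aestronglyMeasurable
    -- `‖u s‖_{L²(B)} = a(s)^{1/2}`
    have hL2 : eLpNorm (u s) 2 (volume.restrict B) = a s ^ (1 / 2 : ℝ) := by
      rw [eLpNorm_eq_lintegral_rpow_enorm_toReal two_ne_zero ENNReal.ofNat_ne_top,
        ENNReal.toReal_ofNat, ha]
      simp only [one_div]
      congr 1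
      refine lintegral_congr fun x => ?_
      rw [show (2 : ℝ) = ((2 : ℕ) : ℝ) by norm_num, ENNReal.rpow_natCast]
    have hL2' : eLpNorm (u s) 2 (volume.restrict B) ≠ ∞ := by
      rw [hL2]; exact ENNReal.rpow_ne_top_of_nonneg (by norm_num) has'
    -- Sobolev on the slice
    have hS : eLpNorm (u s) 6 (volume.restrict B) ≤
        CS * (a s ^ (1 / 2 : ℝ) + e s ^ (1 / 2 : ℝ)) := by
      have := hCS y (u s) (G s) hws hL2'
      rwa [hL2] at this
    have hS2 : eLpNorm (u s) 6 (volume.restrict B) ≤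
        ((2 * CS : ℝ≥0) : ℝ≥0∞) * (a s + e s) ^ (1 / 2 : ℝ) := by
      refine hS.trans ?_
      have h1' : a s ^ (1 / 2 : ℝ) ≤ (a s + e s) ^ (1 / 2 : ℝ) :=
        ENNReal.rpow_le_rpow le_self_add (by norm_num)
      have h2' : e s ^ (1 / 2 : ℝ) ≤ (a s + e s) ^ (1 / 2 : ℝ) :=
        ENNReal.rpow_le_rpow le_add_self (by norm_num)
      calc (CS : ℝ≥0∞) * (a s ^ (1 / 2 : ℝ) + e s ^ (1 / 2 : ℝ))
          ≤ CS * ((a s + e s) ^ (1 / 2 : ℝ) + (a s + e s) ^ (1 / 2 : ℝ)) := by gcongr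
        _ = ((2 * CS : ℝ≥0) : ℝ≥0∞) * (a s + e s) ^ (1 / 2 : ℝ) := by push_cast; ring
    -- `(∫ |u s|⁶)^{1/4} = ‖u s‖_{L⁶}^{3/2}`
    have hL6 : (∫⁻ x in B, ‖u s x‖ₑ ^ (6 : ℝ)) ^ (1 / 4 : ℝ) =
        eLpNorm (u s) 6 (volume.restrict B) ^ (3 / 2 : ℝ) := by
      rw [eLpNorm_eq_lintegral_rpow_enorm_toReal (by norm_num) ENNReal.ofNat_ne_top,
        ENNReal.toReal_ofNat, ← ENNReal.rpow_mul]
      norm_num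
    -- Hölder in space
    have hH := lintegral_pow_three_le_Lp_interpolation (volume.restrict B) hutm.enorm
    calc c s ≤ a s ^ (3 / 4 : ℝ) * (∫⁻ x in B, ‖u s x‖ₑ ^ (6 : ℝ)) ^ (1 / 4 : ℝ) := hH
      _ = a s ^ (3 / 4 : ℝ) * eLpNorm (u s) 6 (volume.restrict B) ^ (3 / 2 : ℝ) := by rw [hL6]
      _ ≤ (C : ℝ≥0∞) ^ (3 / 4 : ℝ) *
            (((2 * CS : ℝ≥0) : ℝ≥0∞) * (a s + e s) ^ (1 / 2 : ℝ)) ^ (3 / 2 : ℝ) := by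
          gcongr
      _ = (C : ℝ≥0∞) ^ (3 / 4 : ℝ) * (M * (a s + e s) ^ (3 / 4 : ℝ)) := by
          rw [hM, ENNReal.mul_rpow_of_nonneg _ _ (by norm_num), ← ENNReal.rpow_mul]
          norm_num
  have hptJ : ∀ᵐ s ∂(volume.restrict J),
      c s ≤ (C : ℝ≥0∞) ^ (3 / 4 : ℝ) * (M * (a s + e s) ^ (3 / 4 : ℝ)) :=
    ae_restrict_of_ae_restrict_of_subset hJI hpt
  -- integrate in time over `J = (0, t)`
  have hMtop : M ≠ ∞ := ENNReal.rpow_ne_top_of_nonneg (by norm_num) ENNReal.coe_ne_top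
  have hK : (C : ℝ≥0∞) ^ (3 / 4 : ℝ) * M ≠ ∞ :=
    ENNReal.mul_ne_top (ENNReal.rpow_ne_top_of_nonneg (by norm_num) ENNReal.coe_ne_top) hMtop
  have hvolJ : (volume.restrict J : Measure ℝ) univ = ENNReal.ofReal t := by
    rw [Measure.restrict_apply_univ, hJ, Real.volume_Ioo, sub_zero]
  have hint_a : ∫⁻ s in J, a s ≤ C * ENNReal.ofReal t := by
    calc ∫⁻ s in J, a s ≤ ∫⁻ _ in J, (C : ℝ≥0∞) :=
          lintegral_mono_ae (ae_restrict_of_ae_restrict_of_subset hJI h1)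
      _ = C * (volume.restrict J) univ := lintegral_const _
      _ = C * ENNReal.ofReal t := by rw [hvolJ]
  have hint_e : ∫⁻ s in J, e s ≤ C := (lintegral_mono_set hJI).trans hEfin
  have ht4 : ENNReal.ofReal t ^ (1 / 4 : ℝ) = ENNReal.ofReal (t ^ (1 / 4 : ℝ)) :=
    ENNReal.ofReal_rpow_of_nonneg ht.le (by norm_num)
  calc ∫⁻ z in J ×ˢ B, ‖u z.1 z.2‖ₑ ^ (3 : ℕ) = ∫⁻ s in J, c s := hCeq
    _ ≤ ∫⁻ s in J, (C : ℝ≥0∞) ^ (3 / 4 : ℝ) * (M * (a s + e s) ^ (3 / 4 : ℝ)) :=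
        lintegral_mono_ae hptJ
    _ = (C : ℝ≥0∞) ^ (3 / 4 : ℝ) * M * ∫⁻ s in J, (a s + e s) ^ (3 / 4 : ℝ) := by
        rw [← lintegral_const_mul' _ _ hK]
        refine lintegral_congr fun s => ?_
        ring
    _ ≤ (C : ℝ≥0∞) ^ (3 / 4 : ℝ) * M *
          ((∫⁻ s in J, (a s + e s)) ^ (3 / 4 : ℝ) * (volume.restrict J) univ ^ (1 / 4 : ℝ)) := by
        gcongr
        exact lintegral_rpow_three_quarters_le_mul _ (hamJ.add hemJ)
    _ ≤ (C : ℝ≥0∞) ^ (3 / 4 : ℝ) * M *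
          ((C * ENNReal.ofReal t + C) ^ (3 / 4 : ℝ) * ENNReal.ofReal t ^ (1 / 4 : ℝ)) := by
        rw [hvolJ]
        gcongr
        rw [lintegral_add_left' hamJ]
        exact add_le_add hint_a hint_e
    _ = M * ((C : ℝ≥0∞) ^ (3 / 4 : ℝ) *
          ((C * ENNReal.ofReal t + C) ^ (3 / 4 : ℝ) * ENNReal.ofReal t ^ (1 / 4 : ℝ))) := by ring
    _ ≤ M * ((C : ℝ≥0∞) ^ (3 / 2 : ℝ) * (ENNReal.ofReal t + ENNReal.ofReal t ^ (1 / 4 : ℝ))) :=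
        mul_le_mul' le_rfl (rpow_three_quarters_bound_aux _ _)
    _ = (((2 * CS) ^ (3 / 2 : ℝ) : ℝ≥0) : ℝ≥0∞) * (C : ℝ≥0∞) ^ (3 / 2 : ℝ) *
          (ENNReal.ofReal t + ENNReal.ofReal (t ^ (1 / 4 : ℝ))) := by
        rw [hM, ENNReal.coe_rpow_of_nonneg _ (by norm_num), ht4]
        ring

end JiaSverak2014

end Literature.Analysis.FluidPDE

end
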